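import Literature.Analysis.InverseSpectral.KreinString
import Literature.Analysis.InverseSpectral.KreinStringProofs
import Literature.Analysis.InverseSpectral.KreinStringCalculus
import Literature.Analysis.InverseSpectral.KreinStringGreen
import HarnessLib

/-!
# Step strings: the Neumann solution of a Kreĭn string with piecewise-constant density

Helper for the line `Sketch` (card `telegraph-string`) of crux `LeeYang.LeeyangThesis`
(stmt-RiemannHypothesis-0451): the STRING half of the finite dictionary "nearest-neighbour chain =
step string". For a Kreĭn string `T` of infinite length with mass density
`ρ(y) = Σ_j d_j 𝟙[s_j ≤ y]` (`0 ≤ s_0 < … < s_{N-1}`, `d_j > 0`; density `P_j² = Σ_{i ≤ j} d_i` on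
`[s_j, s_{j+1})`) and a point `x ≥ s_{N-1}`, the Neumann solution `φ(x, -h²)` (`KreinString.phi`) is
the `(0,0)` entry of the product of the hyperbolic piece matrices
`M_j = !![cosh(h P_j ℓ_j), h P_j sinh(h P_j ℓ_j); sinh(h P_j ℓ_j)/(h P_j), cosh(h P_j ℓ_j)]`,
`ℓ_j = s_{j+1} - s_j` (`ℓ_{N-1} = x - s_{N-1}`): `stub_stringSteps`.

## Proof

The candidate `y(t) = (∏_j M_j(len_j(t)))₀₀` with clamped piece lengths
`len_j(t) = (min(t, s_{j+1}) - s_j)⁺` and its derivative `v = (∏_j M_j(len_j(t)))₀₁` are continuous,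
and on each open piece `y' = v`, `v' = h² ρ y` (explicit `cosh`/`sinh` calculus). A general lemma
(`StringSteps.isSolution_of_hasDerivAt`: FTC off the countable set of breakpoints, the density
formula for `dm = ρ dy` and the iterated-integral form of the Volterra kernel,
`integral_sub_mul_eq_integral_integral`) shows that `y` solves the string equation in integral
form with data `(1, 0)`; uniqueness (`KreinString.IsSolution.eqOn`) identifies it with `φ`.
-/

noncomputable section

-- the sub-problem path `RiemannHypothesis/RiemannHypothesis` (single-conjunct summit, D-0017)
-- duplicates a namespace
set_option linter.dupNamespace false

open MeasureTheory Filter Topology Complex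
open scoped ENNReal

namespace Summit.RiemannHypothesis.RiemannHypothesis.Theorems.LeeYangTelegraphString

open Literature.Analysis.InverseSpectral

/-- Splitting a `List.ofFn` product at an index `k`: if `f` and `g` agree before `k`, `g k = 1`, and
both are `1` after `k`, then `∏ f = (∏ g) · f k`. [folklore] -/
theorem StringSteps.prod_ofFn_eq_mul {Mo : Type*} [Monoid Mo] :
    ∀ (N : ℕ) (f g : Fin N → Mo) (k : Fin N), (∀ j, j < k → f j = g j) → g k = 1 →
      (∀ j, k < j → f j = 1) → (∀ j, k < j → g j = 1) →
      (List.ofFn f).prod = (List.ofFn g).prod * f k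
  | 0, _, _, k, _, _, _, _ => k.elim0
  | N + 1, f, g, k, hlt, hk, hf, hg => by
    rw [List.ofFn_succ', List.ofFn_succ', List.concat_eq_append, List.concat_eq_append,
      List.prod_append, List.prod_append, List.prod_singleton, List.prod_singleton]
    rcases Fin.eq_castSucc_or_eq_last k with ⟨k, rfl⟩ | rfl
    · rw [hf _ (Fin.castSucc_lt_last k), hg _ (Fin.castSucc_lt_last k), mul_one, mul_one]
      exact StringSteps.prod_ofFn_eq_mul N _ _ k
        (fun j hj => hlt _ (Fin.castSucc_lt_castSucc_iff.2 hj)) hk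
        (fun j hj => hf _ (Fin.castSucc_lt_castSucc_iff.2 hj))
        (fun j hj => hg _ (Fin.castSucc_lt_castSucc_iff.2 hj))
    · have hfg : (fun i : Fin N => f i.castSucc) = fun i => g i.castSucc :=
        funext fun i => hlt _ (Fin.castSucc_lt_last i)
      rw [hk, mul_one, hfg]

/-- A `List.ofFn` product of ones is one. [folklore] -/
theorem StringSteps.prod_ofFn_eq_one {Mo : Type*} [Monoid Mo] {N : ℕ} (f : Fin N → Mo)
    (hf : ∀ j, f j = 1) : (List.ofFn f).prod = 1 :=
  List.prod_eq_one (List.forall_mem_ofFn_iff.2 hf)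

/-- Calculus on one piece of constant density `P²`: for the hyperbolic piece matrix
`M(ℓ) = !![cosh(hPℓ), hP sinh(hPℓ); sinh(hPℓ)/(hP), cosh(hPℓ)]` (`hP ≠ 0`) and any constant row data
`A`, the entries `y(u) = (A M(u - c))₀₀`, `v(u) = (A M(u - c))₀₁` satisfy `y' = v` and
`v' = (hP)² y`. [folklore] -/
theorem StringSteps.hasDerivAt_pieceMat (A : Matrix (Fin 2) (Fin 2) ℂ) (h : ℂ) (P c : ℝ)
    (hP : h * (P : ℂ) ≠ 0) (M : ℝ → Matrix (Fin 2) (Fin 2) ℂ)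
    (hM : ∀ ℓ, M ℓ = !![Complex.cosh (h * ((P * ℓ : ℝ) : ℂ)),
        h * (P : ℂ) * Complex.sinh (h * ((P * ℓ : ℝ) : ℂ));
      Complex.sinh (h * ((P * ℓ : ℝ) : ℂ)) / (h * (P : ℂ)), Complex.cosh (h * ((P * ℓ : ℝ) : ℂ))])
    (t : ℝ) :
    HasDerivAt (fun u => (A * M (u - c)) 0 0) ((A * M (t - c)) 0 1) t ∧
      HasDerivAt (fun u => (A * M (u - c)) 0 1) ((h * P) ^ 2 * (A * M (t - c)) 0 0) t := by
  have hθ : ∀ u, HasDerivAt (fun u : ℝ => h * ((P * (u - c) : ℝ) : ℂ)) (h * P) u := by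
    intro u
    have := ((((hasDerivAt_id u).sub_const c).const_mul P).ofReal_comp).const_mul h
    simpa using this
  have hC : ∀ u, HasDerivAt (fun u : ℝ => Complex.cosh (h * ((P * (u - c) : ℝ) : ℂ)))
      (Complex.sinh (h * ((P * (u - c) : ℝ) : ℂ)) * (h * P)) u :=
    fun u => (Complex.hasDerivAt_cosh _).comp u (hθ u)
  have hS : ∀ u, HasDerivAt (fun u : ℝ => Complex.sinh (h * ((P * (u - c) : ℝ) : ℂ)))
      (Complex.cosh (h * ((P * (u - c) : ℝ) : ℂ)) * (h * P)) u :=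
    fun u => (Complex.hasDerivAt_sinh _).comp u (hθ u)
  have hh : h ≠ 0 := left_ne_zero_of_mul hP
  have hP' : (P : ℂ) ≠ 0 := right_ne_zero_of_mul hP
  simp only [hM, Matrix.mul_apply, Fin.sum_univ_two, Matrix.of_apply, Matrix.cons_val_zero,
    Matrix.cons_val_one]
  constructor
  · have := ((hC t).const_mul (A 0 0)).add (((hS t).div_const (h * P)).const_mul (A 0 1))
    refine this.congr_deriv ?_
    rw [mul_div_cancel_right₀ _ hP]
    ring
  · have := (((hS t).const_mul (h * (P : ℂ))).const_mul (A 0 0)).add ((hC t).const_mul (A 0 1))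
    refine this.congr_deriv ?_
    field_simp

/-- **A solution of the string equation from its derivative data.** Let `T` be a string with
mass `dm = ρ dy`, `ρ ≥ 0` bounded measurable. If `y`, `v` are continuous,
`y(0) = 1`, `v(0) = 0`, and off a countable set `y' = v` and `v' = -z ρ y` on `(0, ∞)`, then `y`
solves `dy' + z y dm = 0` in integral form with data `(1, 0)` (`KreinString.IsSolution`): FTC for
`y` and `v`, `∫_{[0,t]} y dm = ∫₀ᵗ ρ y`, and `∫_{[0,x]} (x-u) y dm = ∫₀ˣ ∫_{[0,t]} y dm dt`.
[folklore] -/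
theorem StringSteps.isSolution_of_hasDerivAt (T : KreinString) (ρ : ℝ → ℝ)
    (hρm : Measurable ρ) (hρ0 : ∀ u, 0 ≤ ρ u) (R : ℝ) (hρR : ∀ u, ρ u ≤ R)
    (hTm : T.massMeasure = volume.withDensity fun y => ENNReal.ofReal (ρ y))
    (z : ℂ) (y v : ℝ → ℂ) (hy : Continuous y) (hv : Continuous v) (hy0 : y 0 = 1) (hv0 : v 0 = 0)
    (B : Set ℝ) (hB : B.Countable)
    (hder : ∀ t, 0 < t → t ∉ B → HasDerivAt y (v t) t ∧ HasDerivAt v (-z * (ρ t : ℂ) * y t) t) :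
    T.IsSolution z 1 0 y := by
  refine ⟨hy.continuousOn, fun x hx => ?_⟩
  have hx0 : 0 ≤ x := hx.1
  rw [integral_sub_mul_eq_integral_integral hx0 (T.massMeasure_Icc_lt_top hx).ne
    (T.integrableOn_Icc_of_continuousOn hx hy.continuousOn)]
  -- the inner integral: `z ∫_{[0,t]} y dm = -v(t)`
  have hinner : ∀ t, 0 ≤ t → z * ∫ u in Set.Icc 0 t, y u ∂T.massMeasure = -v t := by
    intro t ht0
    have h1 : ∫ u in Set.Icc 0 t, y u ∂T.massMeasure = ∫ u in Set.Icc 0 t, (ρ u : ℂ) * y u := by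
      rw [hTm, setIntegral_withDensity_eq_setIntegral_toReal_smul hρm.ennreal_ofReal
        (Eventually.of_forall fun _ => ENNReal.ofReal_lt_top) _ measurableSet_Icc]
      refine setIntegral_congr_fun measurableSet_Icc fun u _ => ?_
      rw [ENNReal.toReal_ofReal (hρ0 u), Complex.real_smul]
    have hint : IntervalIntegrable (fun u => -z * (ρ u : ℂ) * y u) volume 0 t := by
      refine (intervalIntegrable_iff_integrableOn_Icc_of_le ht0).2 ?_
      haveI : IsFiniteMeasure ((volume : Measure ℝ).restrict (Set.Icc 0 t)) :=
        isFiniteMeasure_restrict.2 measure_Icc_lt_top.ne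
      have hρi : IntegrableOn (fun u => -z * (ρ u : ℂ)) (Set.Icc 0 t) := by
        refine Integrable.mono' (integrable_const (‖z‖ * R)) ?_ (Eventually.of_forall fun u => ?_)
        · exact ((Complex.continuous_ofReal.measurable.comp hρm).const_mul _).aestronglyMeasurable
        · rw [norm_mul, norm_neg, Complex.norm_real, Real.norm_eq_abs, abs_of_nonneg (hρ0 u)]
          exact mul_le_mul_of_nonneg_left (hρR u) (norm_nonneg _)
      exact hρi.mul_continuousOn hy.continuousOn isCompact_Icc
    have h2 := integral_eq_of_hasDerivAt_off_countable_of_le v _ ht0 hB hv.continuousOn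
      (fun u hu => (hder u hu.1.1 hu.2).2) hint
    have h3 : ∫ u in (0 : ℝ)..t, -z * (ρ u : ℂ) * y u =
        -z * ∫ u in (0 : ℝ)..t, (ρ u : ℂ) * y u := by
      rw [← intervalIntegral.integral_const_mul]
      exact intervalIntegral.integral_congr fun u _ => by ring
    rw [h1, integral_Icc_eq_integral_Ioc, ← intervalIntegral.integral_of_le ht0]
    rw [hv0, sub_zero, h3] at h2
    linear_combination -h2
  have h5 : ∫ t in Set.Icc 0 x, z * (∫ u in Set.Icc 0 t, y u ∂T.massMeasure) =
      ∫ t in Set.Icc 0 x, -v t :=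
    setIntegral_congr_fun measurableSet_Icc fun t ht => hinner t ht.1
  have h4 : z * ∫ t in Set.Icc 0 x, (∫ u in Set.Icc 0 t, y u ∂T.massMeasure) = -(y x - 1) := by
    rw [← integral_const_mul, h5, integral_neg, integral_Icc_eq_integral_Ioc,
      ← intervalIntegral.integral_of_le hx0,
      integral_eq_of_hasDerivAt_off_countable_of_le y v hx0 hB hy.continuousOn
        (fun u hu => (hder u hu.1.1 hu.2).1) (hv.intervalIntegrable _ _), hy0]
  linear_combination h4

/-- **Stub stringSteps — string side of the dictionary.** For a step string `T` (length `∞`, density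
`ρ_{s,d} = Σ_j d_j 𝟙[s_j ≤ ·]` with strictly increasing breakpoints `0 ≤ s_0 < … < s_{N-1}` and
increments `d_j > 0`) and a point `x ≥ s_{N-1}`, `x ≥ 0`: `φ_T(x, -h²) = TP(ℓ, P; h)` with piece
lengths `ℓ_j = s_{j+1} - s_j` (`ℓ_{N-1} = x - s_{N-1}`) and `P_j = √(Σ_{i ≤ j} d_i)` (explicit
solution `cosh / sinh` on each piece, `φ, φ'` continuous across breakpoints, `φ ≡ 1` on `[0, s_0]`;
identification with the Picard series by `isSolution_phi` + `IsSolution.eqOn`). [folklore] -/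
theorem stub_stringSteps : ∀ (N : ℕ) (s d : Fin N → ℝ), StrictMono s → (∀ j, 0 ≤ s j) →
    (∀ j, 0 < d j) → ∀ T : KreinString, T.length = ⊤ →
    T.massMeasure = volume.withDensity
      (fun y => ENNReal.ofReal (∑ j : Fin N, (Set.Ici (s j)).indicator (fun _ => d j) y)) →
    ∀ x : ℝ, 0 ≤ x → (∀ j, s j ≤ x) → ∀ h : ℂ,
      T.phi (-h ^ 2) x =
        (List.ofFn fun j : Fin N =>
          !![Complex.cosh (h * ((Real.sqrt (∑ i ∈ Finset.Iic j, d i) *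
                ((if hj : (j : ℕ) + 1 < N then s ⟨(j : ℕ) + 1, hj⟩ else x) - s j) : ℝ) : ℂ)),
              h * (Real.sqrt (∑ i ∈ Finset.Iic j, d i) : ℂ) *
                Complex.sinh (h * ((Real.sqrt (∑ i ∈ Finset.Iic j, d i) *
                  ((if hj : (j : ℕ) + 1 < N then s ⟨(j : ℕ) + 1, hj⟩ else x) - s j) : ℝ) : ℂ));
            Complex.sinh (h * ((Real.sqrt (∑ i ∈ Finset.Iic j, d i) *
                ((if hj : (j : ℕ) + 1 < N then s ⟨(j : ℕ) + 1, hj⟩ else x) - s j) : ℝ) : ℂ)) /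
                (h * (Real.sqrt (∑ i ∈ Finset.Iic j, d i) : ℂ)),
              Complex.cosh (h * ((Real.sqrt (∑ i ∈ Finset.Iic j, d i) *
                ((if hj : (j : ℕ) + 1 < N then s ⟨(j : ℕ) + 1, hj⟩ else x) - s j) : ℝ) : ℂ))]).prod
          0 0 := by
  intro N s d hs hs0 hd T hT hTm x hx0 hsx h
  have hxdom : x ∈ T.dom := ⟨hx0, by rw [hT]; exact ENNReal.ofReal_lt_top⟩
  -- `h = 0`: every piece matrix is `1` (junk `0/0 = 0`) and `φ(x, 0) = 1`
  rcases eq_or_ne h 0 with rfl | hh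
  · have hsol : T.IsSolution (-(0 : ℂ) ^ 2) 1 0 (fun _ => 1) :=
      ⟨continuousOn_const, fun x _ => by simp⟩
    rw [(T.isSolution_phi _).eqOn hsol hxdom, StringSteps.prod_ofFn_eq_one _ (fun j => ?_)]
    · simp
    · rw [Matrix.one_fin_two]
      simp
  -- data: `P_j`, the piece matrices `M_j(ℓ)`, the clamped piece lengths `len_j(t)`
  obtain ⟨P, hP⟩ : ∃ P : Fin N → ℝ, ∀ j, P j = Real.sqrt (∑ i ∈ Finset.Iic j, d i) :=
    ⟨_, fun _ => rfl⟩
  have hPsq : ∀ j, P j ^ 2 = ∑ i ∈ Finset.Iic j, d i := fun j => by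
    rw [hP, Real.sq_sqrt (Finset.sum_nonneg fun i _ => (hd i).le)]
  have hhP : ∀ j, h * (P j : ℂ) ≠ 0 := fun j => mul_ne_zero hh (Complex.ofReal_ne_zero.2 (by
    rw [hP]
    exact (Real.sqrt_pos.2 (Finset.sum_pos (fun i _ => hd i) ⟨j, Finset.mem_Iic.2 le_rfl⟩)).ne'))
  obtain ⟨M, hM⟩ : ∃ M : Fin N → ℝ → Matrix (Fin 2) (Fin 2) ℂ, ∀ j ℓ, M j ℓ =
      !![Complex.cosh (h * ((P j * ℓ : ℝ) : ℂ)),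
          h * (P j : ℂ) * Complex.sinh (h * ((P j * ℓ : ℝ) : ℂ));
        Complex.sinh (h * ((P j * ℓ : ℝ) : ℂ)) / (h * (P j : ℂ)),
          Complex.cosh (h * ((P j * ℓ : ℝ) : ℂ))] := ⟨_, fun _ _ => rfl⟩
  have hM0 : ∀ j, M j 0 = 1 := fun j => by
    rw [hM, Matrix.one_fin_two]
    simp
  have hMc : ∀ j, Continuous (M j) := fun j => by
    refine continuous_matrix fun i k => ?_
    simp only [hM]
    fin_cases i <;> fin_cases k <;> simp <;> fun_prop
  obtain ⟨len, hlen⟩ : ∃ len : Fin N → ℝ → ℝ, ∀ j t, len j t =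
      max 0 ((if hj : (j : ℕ) + 1 < N then min t (s ⟨(j : ℕ) + 1, hj⟩) else t) - s j) :=
    ⟨_, fun _ _ => rfl⟩
  have hlen0 : ∀ j t, t ≤ s j → len j t = 0 := fun j t ht => by
    rw [hlen]
    refine max_eq_left ?_
    split_ifs with hj
    · linarith [min_le_left t (s ⟨(j : ℕ) + 1, hj⟩)]
    · linarith
  have hlen1 : ∀ j t, s j ≤ t → (∀ hj : (j : ℕ) + 1 < N, t ≤ s ⟨(j : ℕ) + 1, hj⟩) →
      len j t = t - s j := fun j t h1 h2 => by
    rw [hlen]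
    split_ifs with hj
    · rw [min_eq_left (h2 hj), max_eq_right (sub_nonneg.2 h1)]
    · rw [max_eq_right (sub_nonneg.2 h1)]
  have hsucc : ∀ (j : Fin N) (hj : (j : ℕ) + 1 < N), s j ≤ s ⟨(j : ℕ) + 1, hj⟩ := fun j hj =>
    hs.monotone (Fin.le_def.2 (Nat.le_succ _))
  have hlen2 : ∀ (j : Fin N) (t : ℝ) (hj : (j : ℕ) + 1 < N), s ⟨(j : ℕ) + 1, hj⟩ ≤ t →
      len j t = s ⟨(j : ℕ) + 1, hj⟩ - s j := fun j t hj ht => by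
    rw [hlen, dif_pos hj, min_eq_right ht, max_eq_right (sub_nonneg.2 (hsucc j hj))]
  have hlenx : ∀ j, len j x = (if hj : (j : ℕ) + 1 < N then s ⟨(j : ℕ) + 1, hj⟩ else x) - s j := by
    intro j
    rw [hlen]
    split_ifs with hj
    · rw [min_eq_right (hsx _), max_eq_right (sub_nonneg.2 (hsucc j hj))]
    · rw [max_eq_right (sub_nonneg.2 (hsx j))]
  have hlenc : ∀ j, Continuous (len j) := fun j => by
    rw [show len j = _ from funext (hlen j)]
    by_cases hj : (j : ℕ) + 1 < N
    · simp only [dif_pos hj]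
      exact continuous_const.max ((continuous_id.min continuous_const).sub continuous_const)
    · simp only [dif_neg hj]
      exact continuous_const.max (continuous_id.sub continuous_const)
  -- the transfer product `F(t) = ∏_j M_j(len_j(t))`
  obtain ⟨F, hF⟩ : ∃ F : ℝ → Matrix (Fin 2) (Fin 2) ℂ, ∀ t,
      F t = (List.ofFn fun j => M j (len j t)).prod := ⟨_, fun _ => rfl⟩
  have hFc : Continuous F := by
    rw [show F = fun t => ((List.finRange N).map fun j => M j (len j t)).prod from
      funext fun t => by rw [hF, List.ofFn_eq_map]]
    exact continuous_list_prod _ fun j _ => (hMc j).comp (hlenc j)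
  have hF1 : ∀ t, (∀ j, t ≤ s j) → F t = 1 := fun t ht => by
    rw [hF]
    exact StringSteps.prod_ofFn_eq_one _ fun j => by rw [hlen0 j t (ht j), hM0]
  have hFk : ∀ k t, s k ≤ t → (∀ j, k < j → t ≤ s j) → F t = F (s k) * M k (t - s k) := by
    intro k t hkt htj
    rw [hF t, hF (s k), ← hlen1 k t hkt (fun hk => htj ⟨(k : ℕ) + 1, hk⟩
      (Fin.lt_def.2 (Nat.lt_succ_self _)))]
    refine StringSteps.prod_ofFn_eq_mul N _ _ k (fun j hj => ?_) ?_ (fun j hj => ?_)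
      (fun j hj => ?_)
    · have hj1 : (j : ℕ) + 1 < N := lt_of_le_of_lt (Nat.succ_le_of_lt (Fin.lt_def.1 hj)) k.2
      have hle : s ⟨(j : ℕ) + 1, hj1⟩ ≤ s k :=
        hs.monotone (Fin.le_def.2 (Nat.succ_le_of_lt (Fin.lt_def.1 hj)))
      rw [hlen2 j t hj1 (hle.trans hkt), hlen2 j (s k) hj1 hle]
    · rw [hlen1 k (s k) le_rfl (fun hk => hsucc k hk), sub_self, hM0]
    · rw [hlen0 j t (htj j hj), hM0]
    · rw [hlen0 j (s k) (hs.monotone hj.le), hM0]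
  -- the density
  obtain ⟨ρ, hρ⟩ : ∃ ρ : ℝ → ℝ,
      ∀ y, ρ y = ∑ j : Fin N, (Set.Ici (s j)).indicator (fun _ => d j) y := ⟨_, fun _ => rfl⟩
  have hTm' : T.massMeasure = volume.withDensity fun y => ENNReal.ofReal (ρ y) := by
    simpa only [hρ] using hTm
  have hρm : Measurable ρ := by
    rw [show ρ = _ from funext hρ]
    exact Finset.measurable_sum _ fun j _ => measurable_const.indicator measurableSet_Ici
  have hρ0 : ∀ u, 0 ≤ ρ u := fun u => by
    rw [hρ]
    exact Finset.sum_nonneg fun j _ => Set.indicator_nonneg (fun _ _ => (hd j).le) _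
  have hρR : ∀ u, ρ u ≤ ∑ j, d j := fun u => by
    rw [hρ]
    exact Finset.sum_le_sum fun j _ =>
      Set.indicator_apply_le' (fun _ => le_rfl) (fun _ => (hd j).le)
  have hρI : ∀ t, (∀ j, t < s j) → ρ t = 0 := fun t ht => by
    rw [hρ]
    exact Finset.sum_eq_zero fun j _ =>
      Set.indicator_of_notMem (fun hm => (not_le.2 (ht j)) (Set.mem_Ici.1 hm)) _
  have hρk : ∀ k t, s k ≤ t → (∀ j, k < j → t < s j) → ρ t = P k ^ 2 := fun k t hkt htj => by
    rw [hPsq, hρ, ← Finset.sum_subset (Finset.subset_univ (Finset.Iic k))]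
    · exact Finset.sum_congr rfl fun j hj =>
        Set.indicator_of_mem (Set.mem_Ici.2 ((hs.monotone (Finset.mem_Iic.1 hj)).trans hkt)) _
    · intro j _ hj
      exact Set.indicator_of_notMem (fun hm => (not_le.2 (htj j (not_le.1
        (fun hjk => hj (Finset.mem_Iic.2 hjk))))) (Set.mem_Ici.1 hm)) _
  -- every `t ∉ {s_j}` lies in the initial massless region or in an open piece
  have hsplit : ∀ t, (∀ j, s j ≠ t) → (∀ j, t < s j) ∨ ∃ k, s k < t ∧ ∀ j, k < j → t < s j := by
    intro t ht
    by_cases hex : ∃ j, s j < t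
    · right
      classical
      obtain ⟨j0, hj0⟩ := hex
      set A := Finset.univ.filter fun j => s j < t with hA
      have hAne : A.Nonempty := ⟨j0, by simp [hA, hj0]⟩
      refine ⟨A.max' hAne, (Finset.mem_filter.1 (A.max'_mem hAne)).2, fun j hj => ?_⟩
      rcases lt_or_gt_of_ne (ht j) with h1 | h1
      · exact absurd (A.le_max' j (by simp [hA, h1])) (not_le.2 hj)
      · exact h1
    · push Not at hex
      exact Or.inl fun j => lt_of_le_of_ne (hex j) (ht j).symm
  -- `y = F₀₀` solves the string equation with data `(1, 0)` at `z = -h²`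
  have hsol : T.IsSolution (-h ^ 2) 1 0 (fun t => F t 0 0) := by
    refine StringSteps.isSolution_of_hasDerivAt T ρ hρm hρ0 _ hρR hTm' _ _ (fun t => F t 0 1)
      (hFc.matrix_elem 0 0) (hFc.matrix_elem 0 1) ?_ ?_ (Set.range s)
      (Set.finite_range s).countable fun t _ htB => ?_
    · show F 0 0 0 = 1
      rw [hF1 0 fun j => hs0 j, Matrix.one_apply_eq]
    · show F 0 0 1 = 0
      rw [hF1 0 fun j => hs0 j, Matrix.one_apply_ne (by decide)]
    have hne : ∀ j, s j ≠ t := fun j hj => htB ⟨j, hj⟩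
    rcases hsplit t hne with hI | ⟨k, hk, hkj⟩
    · -- massless region: `F ≡ 1` near `t`, `ρ(t) = 0`
      have hFU : ∀ᶠ u in 𝓝 t, F u = 1 :=
        (eventually_all.2 fun j => gt_mem_nhds (hI j)).mono fun u hu => hF1 u fun j => (hu j).le
      have hFt : F t = 1 := hF1 t fun j => (hI j).le
      refine ⟨?_, ?_⟩
      · refine ((hasDerivAt_const t (1 : ℂ)).congr_of_eventuallyEq
          (hFU.mono fun u hu => ?_)).congr_deriv ?_
        · show F u 0 0 = 1
          rw [hu, Matrix.one_apply_eq]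
        · rw [hFt, Matrix.one_apply_ne (by decide)]
      · refine ((hasDerivAt_const t (0 : ℂ)).congr_of_eventuallyEq
          (hFU.mono fun u hu => ?_)).congr_deriv ?_
        · show F u 0 1 = 0
          rw [hu, Matrix.one_apply_ne (by decide)]
        · rw [hρI t hI]
          simp
    · -- open piece `k`: `F(u) = F(s_k) M_k(u - s_k)` near `t`, `ρ(t) = P_k²`
      obtain ⟨h1, h2⟩ :=
        StringSteps.hasDerivAt_pieceMat (F (s k)) h (P k) (s k) (hhP k) (M k) (hM k) t
      have hU : ∀ᶠ u in 𝓝 t, s k < u ∧ ∀ j, k < j → u < s j := by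
        refine (lt_mem_nhds hk).and (eventually_all.2 fun j => ?_)
        by_cases hj : k < j
        · exact (gt_mem_nhds (hkj j hj)).mono fun u hu _ => hu
        · exact Eventually.of_forall fun u hj' => absurd hj' hj
      have hFU : ∀ᶠ u in 𝓝 t, F u = F (s k) * M k (u - s k) :=
        hU.mono fun u hu => hFk k u hu.1.le fun j hj => (hu.2 j hj).le
      have hFt : F t = F (s k) * M k (t - s k) := hFk k t hk.le fun j hj => (hkj j hj).le
      refine ⟨?_, ?_⟩
      · refine (h1.congr_of_eventuallyEq (hFU.mono fun u hu => ?_)).congr_deriv ?_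
        · show F u 0 0 = (F (s k) * M k (u - s k)) 0 0
          rw [hu]
        · rw [hFt]
      · refine (h2.congr_of_eventuallyEq (hFU.mono fun u hu => ?_)).congr_deriv ?_
        · show F u 0 1 = (F (s k) * M k (u - s k)) 0 1
          rw [hu]
        · rw [hFt, hρk k t hk.le hkj]
          push_cast
          ring
  -- uniqueness: `φ(x, -h²) = y(x) = F(x)₀₀`, and `F(x)` is the product in the statement
  rw [(T.isSolution_phi _).eqOn hsol hxdom]
  simp only [hF, hM, hP, hlenx]

end Summit.RiemannHypothesis.RiemannHypothesis.Theorems.LeeYangTelegraphString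

end
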